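import Literature.Probability.LatticeModels.LatticeLaplacianZd
import Literature.Probability.LatticeModels.LatticeGreenAsymptotics
import Summits.CriticalPhenomena.Ising3DConformalLimit.Theorems.InverseSquareTelemetryEtaBoundsFromTelemetryBarriers
import Summits.CriticalPhenomena.Ising3DConformalLimit.Theorems.InverseSquareTelemetryPositiveSolutionAsymptoticsGreenModulation
import HarnessLib

/-!
# Crux `PositiveSolutionAsymptotics` (stmt-CriticalPhenomena-4496), stub H3₋: the sub-profile

THEOREM-ONLY file (no definitions, no named facts), `--supports stmt-CriticalPhenomena-4496`.
`stub_subProfile` is stub H3₋ of the registered skeleton of crux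
`…Theses.InverseSquareTelemetry.PositiveSolutionAsymptotics`. Data: an abstract Green-like
`G : ℤ³ → ℝ`, positive, `ΔG = 0` off the origin, `ΔG(0) = -1`, `|G(x) - a₀/|x|| ≤ K/|x|³`, and the
modulation bounds of stub H2, `a₀/|z| ≤ Φ_G(z) ≤ 3a₀/|z|` for `|z| ≥ r₃`, where `|z| = √(Σᵢ zᵢ²)` and
`Φ_G(z) := 6 G(z) + 2 Σᵢ zᵢ (G(z+eᵢ) - G(z-eᵢ))`. Profile: with the finite bad set
`F₀ = {w ≠ 0, |w| < r₃}`, `B = max (G 0) (a₀ + K) ≥ G`, `λ = 2 r₃ B + (2B + 1 + 2a₀)`,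

  `Γ(y) = G(y) · (1 + |y|²/(4R²)) - (λ/R²) Σ_{w ∈ F₀} G(y - w)`.

By the discrete product rule (`|z ± eᵢ|² = |z|² ± 2zᵢ + 1`, `Δ|·|² = 6`) and `Δ Σ_w G(· - w) = -𝟙_{F₀}`,
`ΔΓ(z) = (1 + |z|²/(4R²) + 1/(4R²)) ΔG(z) + Φ_G(z)/(4R²) + (λ/R²) 𝟙_{F₀}(z)`; this is
`≥ a₀/(4R²|z|)` on `r₃ ≤ |z| ≤ 3R`, `≥ (λ - 3r₃B/2)/R²` on `F₀`, `≥ -1 - 1/(4R²)` at `0`, which absorbs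
`|V| (|Γ| + τ)` for `|V| ≤ c₁/R²`, `τ ≤ 2a₀/R`, `R ≥ R₀`; and `Γ ≍ a₀/|z|` on `R/8 ≤ |z| ≤ 3R` (there
`K/|z|³, (λ/R²)ΣG ≤ a₀/(16|z|)`). Order: lattice identities, a priori bounds, real arithmetic, the stub. -/

noncomputable section

namespace Summit.CriticalPhenomena.Ising3DConformalLimit.Theorems.PositiveSolutionAsymptotics

open Literature.Probability.LatticeModels Finset

/-! ### Discrete product rule and the Green potential of a finite set -/

/-- **Discrete product rule for a quadratic weight**: for `G : ℤ³ → ℝ` and `β γ : ℝ`,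
`Δ(G · (β + γ|·|²))(z) = (β + γ|z|² + γ) ΔG(z) + γ Φ_G(z)` (expand the six neighbours with
`|z ± eᵢ|² = |z|² ± 2 zᵢ + 1`). [folklore] -/
theorem subProfile_laplacian_mul_quad (G : Site 3 → ℝ) (β γ : ℝ) (z : Site 3) :
    latticeLaplacianZd (fun y => G y * (β + γ * ∑ j, ((y j : ℤ) : ℝ) ^ 2)) z =
      (β + γ * ∑ j, ((z j : ℤ) : ℝ) ^ 2 + γ) * latticeLaplacianZd G z +
        γ * (6 * G z + 2 * ∑ i : Fin 3, ((z i : ℤ) : ℝ) *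
          (G (z + Pi.single i 1) - G (z - Pi.single i 1))) := by
  simp only [latticeLaplacianZd_three, greenMod_sumSq_add_single, greenMod_sumSq_sub_single]
  simp only [Fin.sum_univ_three]
  ring

/-- **Green potential of a finite set.** If `ΔG = 0` off the origin and `ΔG(0) = -1`, the
potential `Ξ(y) = Σ_{w ∈ s} G(y - w)` of a finite `s ⊆ ℤ³` has `ΔΞ = -𝟙_s` (linearity and
translation covariance of `Δ`). [folklore] -/
theorem subProfile_laplacian_potential {G : Site 3 → ℝ}
    (hG0 : ∀ x : Site 3, x ≠ 0 → latticeLaplacianZd G x = 0) (hG1 : latticeLaplacianZd G 0 = -1)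
    (s : Finset (Site 3)) (z : Site 3) :
    latticeLaplacianZd (fun y => ∑ w ∈ s, G (y - w)) z = if z ∈ s then -1 else 0 := by
  classical
  have hlin : ∀ t : Finset (Site 3), latticeLaplacianZd (fun y => ∑ w ∈ t, G (y - w)) z =
      ∑ w ∈ t, latticeLaplacianZd (fun y => G (y - w)) z := by
    intro t
    induction t using Finset.induction_on with
    | empty => simp [latticeLaplacianZd_def]
    | insert a t ha ih =>
      simp only [Finset.sum_insert ha]
      rw [show (fun y => G (y - a) + ∑ w ∈ t, G (y - w)) =
          (fun y => G (y - a)) + fun y => ∑ w ∈ t, G (y - w) from rfl, latticeLaplacianZd_add, ih]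
  have h : ∀ w ∈ s, latticeLaplacianZd (fun y => G (y - w)) z = if z = w then -1 else 0 := by
    intro w _
    rw [show (fun y => G (y - w)) = fun y => G (y + -w) from by simp [sub_eq_add_neg],
      latticeLaplacianZd_comp_add, ← sub_eq_add_neg]
    split_ifs with hzw
    · rw [hzw, sub_self, hG1]
    · exact hG0 _ (sub_ne_zero.2 hzw)
  rw [hlin, Finset.sum_congr rfl h, Finset.sum_ite_eq]

/-- **Laplacian of the profile** `Γ(y) = G(y) (1 + γ|y|²) - μ Σ_{w ∈ s} G(y - w)` when `ΔG = 0` off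
the origin and `ΔG(0) = -1`: `ΔΓ(z) = (1 + γ|z|² + γ) ΔG(z) + γ Φ_G(z) + μ 𝟙_s(z)`. [folklore] -/
theorem subProfile_laplacian_profile {G : Site 3 → ℝ}
    (hG0 : ∀ x : Site 3, x ≠ 0 → latticeLaplacianZd G x = 0) (hG1 : latticeLaplacianZd G 0 = -1)
    (s : Finset (Site 3)) (γ μ : ℝ) (z : Site 3) :
    latticeLaplacianZd (fun y => G y * (1 + γ * ∑ j, ((y j : ℤ) : ℝ) ^ 2) -
        μ * ∑ w ∈ s, G (y - w)) z =
      (1 + γ * ∑ j, ((z j : ℤ) : ℝ) ^ 2 + γ) * latticeLaplacianZd G z +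
        γ * (6 * G z + 2 * ∑ i : Fin 3, ((z i : ℤ) : ℝ) *
          (G (z + Pi.single i 1) - G (z - Pi.single i 1))) +
        μ * (if z ∈ s then 1 else 0) := by
  rw [(EtaBoundsFromTelemetry.latticeLaplacianZd_sub_const_mul _ _ μ z).1,
    subProfile_laplacian_mul_quad, subProfile_laplacian_potential hG0 hG1]
  split_ifs <;> ring

/-! ### A priori bounds -/

/-- `G ≤ max (G 0) (a₀ + K)` when `|G(x) - a₀/|x|| ≤ K/|x|³` off the origin (`|x| ≥ 1` there).
[folklore] -/
theorem subProfile_G_le {G : Site 3 → ℝ} {a₀ K : ℝ} (ha : 0 < a₀) (hK : 0 ≤ K)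
    (hGasym : ∀ x : Site 3, x ≠ 0 → |G x - a₀ / Real.sqrt (∑ i, ((x i : ℤ) : ℝ) ^ 2)| ≤
      K / Real.sqrt (∑ i, ((x i : ℤ) : ℝ) ^ 2) ^ 3) (x : Site 3) :
    G x ≤ max (G 0) (a₀ + K) := by
  by_cases hx : x = 0
  · rw [hx]; exact le_max_left _ _
  refine le_trans ?_ (le_max_right _ _)
  have h1 : 1 ≤ Real.sqrt (∑ i, ((x i : ℤ) : ℝ) ^ 2) := one_le_sqrt_sum_sq_of_ne_zero hx
  have h := (abs_le.1 (hGasym x hx)).2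
  have ha' : a₀ / Real.sqrt (∑ i, ((x i : ℤ) : ℝ) ^ 2) ≤ a₀ := div_le_self ha.le h1
  have hK' : K / Real.sqrt (∑ i, ((x i : ℤ) : ℝ) ^ 2) ^ 3 ≤ K := div_le_self hK (one_le_pow₀ h1)
  linarith

/-- For `0 < G ≤ B` and a finite `s`: `0 ≤ Σ_{w ∈ s} G(z - w) ≤ #s · B`. [folklore] -/
theorem subProfile_potential_bounds {G : Site 3 → ℝ} {B : ℝ} (hGpos : ∀ x, 0 < G x)
    (hGle : ∀ x, G x ≤ B) (s : Finset (Site 3)) (z : Site 3) :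
    0 ≤ ∑ w ∈ s, G (z - w) ∧ ∑ w ∈ s, G (z - w) ≤ s.card * B := by
  refine ⟨Finset.sum_nonneg fun w _ => (hGpos _).le, ?_⟩
  have h := Finset.sum_le_card_nsmul s (fun w => G (z - w)) B (fun w _ => hGle _)
  simpa [nsmul_eq_mul] using h

/-- Crude lower bound on the modulation near the origin: for `0 < G ≤ B` and `|z| ≤ ρ`,
`Φ_G(z) ≥ -6 ρ B` (`|zᵢ| ≤ |z|`, `|G(z+eᵢ) - G(z-eᵢ)| ≤ B`, `G(z) > 0`). [folklore] -/
theorem subProfile_phi_lower {G : Site 3 → ℝ} {B ρ : ℝ} (hGpos : ∀ x, 0 < G x)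
    (hGle : ∀ x, G x ≤ B) (z : Site 3) (hz : Real.sqrt (∑ i, ((z i : ℤ) : ℝ) ^ 2) ≤ ρ) :
    -(6 * ρ * B) ≤
      6 * G z + 2 * ∑ i : Fin 3, ((z i : ℤ) : ℝ) * (G (z + Pi.single i 1) - G (z - Pi.single i 1)) := by
  have hterm : ∀ i, -(ρ * B) ≤ ((z i : ℤ) : ℝ) * (G (z + Pi.single i 1) - G (z - Pi.single i 1)) := by
    intro i
    have hsq : ((z i : ℤ) : ℝ) ^ 2 ≤ ∑ j, ((z j : ℤ) : ℝ) ^ 2 :=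
      Finset.single_le_sum (f := fun j => ((z j : ℤ) : ℝ) ^ 2) (fun j _ => sq_nonneg _)
        (Finset.mem_univ i)
    have hzi : |((z i : ℤ) : ℝ)| ≤ ρ := (Real.abs_le_sqrt hsq).trans hz
    have hd : |G (z + Pi.single i 1) - G (z - Pi.single i 1)| ≤ B := by
      rw [abs_sub_le_iff]
      constructor <;>
        linarith [hGpos (z + Pi.single i 1), hGpos (z - Pi.single i 1), hGle (z + Pi.single i 1),
          hGle (z - Pi.single i 1)]
    have h := mul_le_mul hzi hd (abs_nonneg _) ((abs_nonneg _).trans hzi)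
    rw [← abs_mul] at h
    linarith [neg_abs_le (((z i : ℤ) : ℝ) * (G (z + Pi.single i 1) - G (z - Pi.single i 1)))]
  rw [Fin.sum_univ_three]
  linarith [hterm 0, hterm 1, hterm 2, hGpos z]

/-! ### The real arithmetic of the sub-profile -/

/-- `V x ≤ c b` whenever `|V| ≤ c` and `|x| ≤ b`. [folklore] -/
theorem subProfile_mul_le {V x c b : ℝ} (hV : |V| ≤ c) (hx : |x| ≤ b) : V * x ≤ c * b :=
  (le_abs_self _).trans
    ((abs_mul V x).trans_le (mul_le_mul hV hx (abs_nonneg _) ((abs_nonneg _).trans hV)))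

/-- **Far sites** (`r = |z| ∈ [1, 3R]`, `R ≥ 1`): if `0 ≤ g ≤ a₀/r + K/r³`, `0 ≤ X ≤ 1/r`,
`0 ≤ τ ≤ 2a₀/R`, `|V| ≤ c₁/R²`, `c₁ ((13/4)(a₀+K) + 1 + 6a₀) ≤ a₀/4` and `Φ ≥ a₀/r`, then
`V (g(1 + r²/(4R²)) - X - τ) ≤ Φ/(4R²)` (as `|g ψ - X - τ| ≤ ((13/4)(a₀+K) + 1 + 6a₀)/r`). [folklore] -/
theorem subProfile_arith_far {a₀ K R r g X τ V Φ c₁ : ℝ} (ha : 0 < a₀) (hK : 0 ≤ K)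
    (hr1 : 1 ≤ r) (hrR : r ≤ 3 * R) (hR : 1 ≤ R) (hg0 : 0 ≤ g) (hg : g ≤ a₀ / r + K / r ^ 3)
    (hX0 : 0 ≤ X) (hX : X ≤ 1 / r) (hτ0 : 0 ≤ τ) (hτ : τ ≤ 2 * a₀ / R)
    (hV : |V| ≤ c₁ / R ^ 2) (hc₁ : c₁ * (13 / 4 * (a₀ + K) + 1 + 6 * a₀) ≤ a₀ / 4)
    (hΦ : a₀ / r ≤ Φ) :
    V * (g * (1 + 1 / (4 * R ^ 2) * r ^ 2) - X - τ) ≤ 1 / (4 * R ^ 2) * Φ := by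
  have hr0 : 0 < r := by linarith
  have hR0 : 0 < R := by linarith
  have hK3 : K / r ^ 3 ≤ K / r :=
    div_le_div_of_nonneg_left hK hr0 (le_self_pow₀ hr1 three_ne_zero)
  have hg' : g ≤ (a₀ + K) / r := by rw [add_div]; linarith
  have hψ : 1 + 1 / (4 * R ^ 2) * r ^ 2 ≤ 13 / 4 := by
    have h : r ^ 2 / (4 * R ^ 2) ≤ 9 / 4 := by
      rw [div_le_iff₀ (by positivity)]; nlinarith
    have e : 1 / (4 * R ^ 2) * r ^ 2 = r ^ 2 / (4 * R ^ 2) := by ring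
    linarith
  have hψ0 : 0 ≤ 1 + 1 / (4 * R ^ 2) * r ^ 2 := by positivity
  have hτ' : τ ≤ 6 * a₀ / r := hτ.trans (by rw [div_le_div_iff₀ hR0 hr0]; nlinarith)
  have habs : |g * (1 + 1 / (4 * R ^ 2) * r ^ 2) - X - τ| ≤
      (13 / 4 * (a₀ + K) + 1 + 6 * a₀) / r := by
    have hgψ : g * (1 + 1 / (4 * R ^ 2) * r ^ 2) ≤ (a₀ + K) / r * (13 / 4) :=
      mul_le_mul hg' hψ hψ0 (by positivity)
    have hgψ0 : 0 ≤ g * (1 + 1 / (4 * R ^ 2) * r ^ 2) := mul_nonneg hg0 hψ0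
    have e : (13 / 4 * (a₀ + K) + 1 + 6 * a₀) / r =
        (a₀ + K) / r * (13 / 4) + 1 / r + 6 * a₀ / r := by ring
    rw [e, abs_le]
    constructor <;> linarith
  calc V * (g * (1 + 1 / (4 * R ^ 2) * r ^ 2) - X - τ)
        ≤ c₁ / R ^ 2 * ((13 / 4 * (a₀ + K) + 1 + 6 * a₀) / r) := subProfile_mul_le hV habs
    _ = c₁ * (13 / 4 * (a₀ + K) + 1 + 6 * a₀) / (R ^ 2 * r) := div_mul_div_comm _ _ _ _
    _ ≤ (a₀ / 4) / (R ^ 2 * r) := div_le_div_of_nonneg_right hc₁ (by positivity)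
    _ = 1 / (4 * R ^ 2) * (a₀ / r) := by field_simp
    _ ≤ 1 / (4 * R ^ 2) * Φ := mul_le_mul_of_nonneg_left hΦ (by positivity)

/-- **Near sites** (`0 ≤ r ≤ R`, `R ≥ 1`): if `0 ≤ g ≤ B`, `0 ≤ X ≤ 1`, `0 ≤ τ ≤ 2a₀/R`, `|V| ≤ c₁/R²`,
`c₁ ≤ 1` and `Φ ≥ -6 r₃ B`, then `V (g(1 + r²/(4R²)) - X - τ) ≤ Φ/(4R²) + λ/R²` for
`λ = 2 r₃ B + (2B + 1 + 2a₀)` (as `|g ψ - X - τ| ≤ 2B + 1 + 2a₀`). [folklore] -/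
theorem subProfile_arith_near {a₀ B r₃ R r g X τ V Φ c₁ : ℝ} (ha : 0 < a₀) (hB : 0 ≤ B)
    (hr₃ : 0 ≤ r₃) (hr0 : 0 ≤ r) (hrR : r ≤ R) (hR : 1 ≤ R)
    (hg0 : 0 ≤ g) (hg : g ≤ B) (hX0 : 0 ≤ X) (hX : X ≤ 1) (hτ0 : 0 ≤ τ) (hτ : τ ≤ 2 * a₀ / R)
    (hV : |V| ≤ c₁ / R ^ 2) (hc₁ : c₁ ≤ 1) (hΦ : -(6 * r₃ * B) ≤ Φ) :
    V * (g * (1 + 1 / (4 * R ^ 2) * r ^ 2) - X - τ) ≤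
      1 / (4 * R ^ 2) * Φ + (2 * r₃ * B + (2 * B + 1 + 2 * a₀)) / R ^ 2 := by
  have hR0 : 0 < R := by linarith
  have hψ : 1 + 1 / (4 * R ^ 2) * r ^ 2 ≤ 5 / 4 := by
    have h : r ^ 2 / (4 * R ^ 2) ≤ 1 / 4 := by
      rw [div_le_iff₀ (by positivity)]; nlinarith [mul_self_le_mul_self hr0 hrR]
    have e : 1 / (4 * R ^ 2) * r ^ 2 = r ^ 2 / (4 * R ^ 2) := by ring
    linarith
  have hψ0 : 0 ≤ 1 + 1 / (4 * R ^ 2) * r ^ 2 := by positivity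
  have hτ' : τ ≤ 2 * a₀ := hτ.trans (div_le_self (by positivity) hR)
  have habs : |g * (1 + 1 / (4 * R ^ 2) * r ^ 2) - X - τ| ≤ 2 * B + 1 + 2 * a₀ := by
    have hgψ : g * (1 + 1 / (4 * R ^ 2) * r ^ 2) ≤ B * (5 / 4) := mul_le_mul hg hψ hψ0 hB
    have hgψ0 : 0 ≤ g * (1 + 1 / (4 * R ^ 2) * r ^ 2) := mul_nonneg hg0 hψ0
    rw [abs_le]
    constructor <;> nlinarith
  have h1 := subProfile_mul_le hV habs
  have h2 : c₁ / R ^ 2 * (2 * B + 1 + 2 * a₀) ≤ (2 * B + 1 + 2 * a₀) / R ^ 2 := by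
    rw [div_mul_eq_mul_div]
    exact div_le_div_of_nonneg_right (by nlinarith) (by positivity)
  have h3 : 1 / (4 * R ^ 2) * -(6 * r₃ * B) ≤ 1 / (4 * R ^ 2) * Φ :=
    mul_le_mul_of_nonneg_left hΦ (by positivity)
  have h4 : 1 / (4 * R ^ 2) * -(6 * r₃ * B) + (2 * r₃ * B + (2 * B + 1 + 2 * a₀)) / R ^ 2
      = (2 * B + 1 + 2 * a₀) / R ^ 2 + (r₃ * B / 2) / R ^ 2 := by
    field_simp
    ring
  have h5 : 0 ≤ (r₃ * B / 2) / R ^ 2 := by positivity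
  linarith

/-- **The origin** (`R ≥ 1`): if `0 ≤ g ≤ B`, `0 ≤ X ≤ 1`, `0 ≤ τ ≤ 2a₀/R`, `|V| ≤ c₁/R²` and
`c₁ (2B + 1 + 2a₀) ≤ 1/2`, then `V (g - X - τ) - 2 ≤ -(1 + 1/(4R²)) + 6g/(4R²)`
(left side `≤ 1/2 - 2`, right side `≥ -5/4`). [folklore] -/
theorem subProfile_arith_origin {a₀ B R g X τ V c₁ : ℝ} (ha : 0 < a₀) (hR : 1 ≤ R)
    (hg0 : 0 ≤ g) (hg : g ≤ B) (hX0 : 0 ≤ X) (hX : X ≤ 1) (hτ0 : 0 ≤ τ) (hτ : τ ≤ 2 * a₀ / R)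
    (hV : |V| ≤ c₁ / R ^ 2) (hc₁ : c₁ * (2 * B + 1 + 2 * a₀) ≤ 1 / 2) :
    V * (g - X - τ) - 2 ≤ -(1 + 1 / (4 * R ^ 2)) + 1 / (4 * R ^ 2) * (6 * g) := by
  have hR0 : 0 < R := by linarith
  have hτ' : τ ≤ 2 * a₀ := hτ.trans (div_le_self (by positivity) hR)
  have habs : |g - X - τ| ≤ 2 * B + 1 + 2 * a₀ := by
    rw [abs_le]; constructor <;> nlinarith
  have h1 := subProfile_mul_le hV habs
  have h2 : c₁ / R ^ 2 * (2 * B + 1 + 2 * a₀) ≤ 1 / 2 := by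
    rw [div_mul_eq_mul_div, div_le_iff₀ (by positivity)]; nlinarith
  have h3 : 1 / (4 * R ^ 2) ≤ 1 / 4 :=
    div_le_div_of_nonneg_left zero_le_one (by norm_num) (by nlinarith)
  have h4 : 0 ≤ 1 / (4 * R ^ 2) * (6 * g) := by positivity
  linarith

/-- **Two-sided size bound** (`R/8 ≤ r ≤ 3R`, `R ≥ 1`): if `|g - a₀/r| ≤ K/r³`, `1024 K ≤ a₀ R`,
`0 ≤ X`, `X R² ≤ P` and `48 P ≤ a₀ R`, then with `ψ = 1 + r²/(4R²)`:
`(7/8) a₀/r ≤ g ψ - X ≤ (9/8)(a₀/r) ψ` (both `K/r³` and `X` are `≤ a₀/(16 r)`). [folklore] -/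
theorem subProfile_arith_size {a₀ K R P r g X : ℝ} (ha : 0 < a₀) (hR1 : 1 ≤ R)
    (hz1 : R / 8 ≤ r) (hz3 : r ≤ 3 * R) (hg : |g - a₀ / r| ≤ K / r ^ 3)
    (hRK : 1024 * K ≤ a₀ * R) (hX0 : 0 ≤ X) (hXR : X * R ^ 2 ≤ P) (hRP : 48 * P ≤ a₀ * R) :
    7 / 8 * (a₀ / r) ≤ g * (1 + r ^ 2 / (4 * R ^ 2)) - X ∧
      g * (1 + r ^ 2 / (4 * R ^ 2)) - X ≤ 9 / 8 * (a₀ / r) * (1 + r ^ 2 / (4 * R ^ 2)) := by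
  have hR0 : 0 < R := by linarith
  have hr0 : 0 < r := (div_pos hR0 (by norm_num)).trans_le hz1
  have hKr : 16 * K ≤ a₀ * r ^ 2 := by
    have h1 : R ^ 2 ≤ 64 * r ^ 2 := by nlinarith
    have h2 : 1024 * K ≤ a₀ * R ^ 2 :=
      hRK.trans (mul_le_mul_of_nonneg_left (le_self_pow₀ hR1 two_ne_zero) ha.le)
    nlinarith [mul_le_mul_of_nonneg_left h1 ha.le]
  have hXr : 16 * X * r ≤ a₀ := by
    have h3 : 16 * X * r ≤ 48 * X * R := by nlinarith [mul_le_mul_of_nonneg_left hz3 hX0]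
    have h4 : 48 * X * R * R ≤ a₀ * R := by nlinarith
    linarith [le_of_mul_le_mul_right h4 hR0]
  have hψ : 1 ≤ 1 + r ^ 2 / (4 * R ^ 2) := le_add_of_nonneg_right (by positivity)
  generalize 1 + r ^ 2 / (4 * R ^ 2) = ψ at hψ ⊢
  obtain ⟨hg1, hg2⟩ := abs_le.1 hg
  have har : 0 < a₀ / r := div_pos ha hr0
  have hK3 : K / r ^ 3 ≤ (a₀ / r) / 16 := by
    rw [div_div, div_le_div_iff₀ (by positivity) (by positivity)]; nlinarith
  have hX' : X ≤ (a₀ / r) / 16 := by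
    rw [div_div, le_div_iff₀ (by positivity)]; linarith
  have hg0 : 0 ≤ g := by linarith
  constructor
  · linarith [le_mul_of_one_le_right hg0 hψ]
  · have : g * ψ ≤ (a₀ / r + (a₀ / r) / 16) * ψ :=
      mul_le_mul_of_nonneg_right (by linarith) (by linarith)
    nlinarith

/-! ### The stub -/

/-- **H3₋ (the sub-profile).** Let `G : ℤ³ → ℝ` be positive, harmonic off the origin with
`ΔG(0) = -1`, with `|G(x) - a₀/|x|| ≤ K/|x|³` and the modulation bounds of H2 beyond `r₃`. Then
there are `R₀` and `c₁ > 0` such that for every `R ≥ R₀` the profile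
`Γ = G·(1 + |·|²/(4R²)) - (λ/R²) Σ_{0<|w|<r₃} G(· - w)` (`λ = 2r₃B + 2B + 1 + 2a₀`,
`B = max (G 0) (a₀ + K)`) satisfies, for every potential `V` with `|V| ≤ c₁/R²` on `{|z| ≤ 3R}` and
every shift `0 ≤ τ ≤ 2a₀/R`: `V·(Γ - τ) ≤ ΔΓ` on `{0 < |z| ≤ 3R}`, `V(0)(Γ(0) - τ) - 2 ≤ ΔΓ(0)`, and
`(7/8) a₀/|z| ≤ Γ(z) ≤ (9/8)(a₀/|z|)(1 + |z|²/(4R²))` on `R/8 ≤ |z| ≤ 3R`. Constants: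
`R₀ = r₃ + 3P + 48P/a₀ + 1024K/a₀` (`P = λ · #F₀ · B`), `c₁ = min (1/(2(2B+1+2a₀))) (a₀/(4((13/4)(a₀+K)+1+6a₀)))`.
[folklore] -/
theorem stub_subProfile :
    ∀ (G : Literature.Probability.LatticeModels.Site 3 → ℝ) (a₀ K r₃ : ℝ), 0 < a₀ → 0 ≤ K → 1 ≤ r₃ →
      (∀ x : Literature.Probability.LatticeModels.Site 3, x ≠ 0 → Literature.Probability.LatticeModels.latticeLaplacianZd G x = 0) →
      Literature.Probability.LatticeModels.latticeLaplacianZd G 0 = -1 →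
      (∀ x : Literature.Probability.LatticeModels.Site 3, 0 < G x) →
      (∀ x : Literature.Probability.LatticeModels.Site 3, x ≠ 0 → |G x - a₀ / Real.sqrt (∑ i, ((x i : ℤ) : ℝ) ^ 2)| ≤ K / Real.sqrt (∑ i, ((x i : ℤ) : ℝ) ^ 2) ^ 3) →
      (∀ z : Literature.Probability.LatticeModels.Site 3, r₃ ≤ Real.sqrt (∑ i, ((z i : ℤ) : ℝ) ^ 2) →
        a₀ / Real.sqrt (∑ i, ((z i : ℤ) : ℝ) ^ 2) ≤ 6 * G z + 2 * ∑ i : Fin 3, ((z i : ℤ) : ℝ) * (G (z + Pi.single i 1) - G (z - Pi.single i 1)) ∧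
        6 * G z + 2 * ∑ i : Fin 3, ((z i : ℤ) : ℝ) * (G (z + Pi.single i 1) - G (z - Pi.single i 1)) ≤ 3 * a₀ / Real.sqrt (∑ i, ((z i : ℤ) : ℝ) ^ 2)) →
      ∃ (R₀ c₁ : ℝ), 0 < c₁ ∧ ∀ R : ℝ, R₀ ≤ R → ∃ Γ : Literature.Probability.LatticeModels.Site 3 → ℝ,
        (∀ (V : Literature.Probability.LatticeModels.Site 3 → ℝ) (τ : ℝ), 0 ≤ τ → τ ≤ 2 * a₀ / R →
          (∀ z : Literature.Probability.LatticeModels.Site 3, Real.sqrt (∑ i, ((z i : ℤ) : ℝ) ^ 2) ≤ 3 * R → |V z| ≤ c₁ / R ^ 2) →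
          (∀ z : Literature.Probability.LatticeModels.Site 3, z ≠ 0 → Real.sqrt (∑ i, ((z i : ℤ) : ℝ) ^ 2) ≤ 3 * R →
              V z * (Γ z - τ) ≤ Literature.Probability.LatticeModels.latticeLaplacianZd Γ z) ∧
            V 0 * (Γ 0 - τ) - 2 ≤ Literature.Probability.LatticeModels.latticeLaplacianZd Γ 0) ∧
        (∀ z : Literature.Probability.LatticeModels.Site 3, R / 8 ≤ Real.sqrt (∑ i, ((z i : ℤ) : ℝ) ^ 2) → Real.sqrt (∑ i, ((z i : ℤ) : ℝ) ^ 2) ≤ 3 * R →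
          7 / 8 * (a₀ / Real.sqrt (∑ i, ((z i : ℤ) : ℝ) ^ 2)) ≤ Γ z ∧
            Γ z ≤ 9 / 8 * (a₀ / Real.sqrt (∑ i, ((z i : ℤ) : ℝ) ^ 2)) * (1 + Real.sqrt (∑ i, ((z i : ℤ) : ℝ) ^ 2) ^ 2 / (4 * R ^ 2))) := by
  intro G a₀ K r₃ ha hK hr₃ hG0 hG1 hGpos hGasym hmod
  -- the finite bad set `F₀ = {w ≠ 0, |w| < r₃}` as a finset `S`
  obtain ⟨S, hS⟩ : ∃ S : Finset (Site 3), ∀ w : Site 3, w ∈ S ↔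
      w ≠ 0 ∧ Real.sqrt (∑ i, ((w i : ℤ) : ℝ) ^ 2) < r₃ := by
    have hfin : {w : Site 3 | w ≠ 0 ∧ Real.sqrt (∑ i, ((w i : ℤ) : ℝ) ^ 2) < r₃}.Finite := by
      refine (EtaBoundsFromTelemetry.finite_sumSq_le (r₃ ^ 2)).subset ?_
      rintro w ⟨-, hw⟩
      exact ((Real.sqrt_lt' (by linarith)).1 hw).le
    exact ⟨hfin.toFinset, fun w => by rw [Set.Finite.mem_toFinset, Set.mem_setOf_eq]⟩
  -- constants
  have hGle : ∀ x, G x ≤ max (G 0) (a₀ + K) := subProfile_G_le ha hK hGasym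
  set B : ℝ := max (G 0) (a₀ + K)
  have hB0 : 0 ≤ B := (hGpos 0).le.trans (hGle 0)
  set lam : ℝ := 2 * r₃ * B + (2 * B + 1 + 2 * a₀)
  have hlam0 : 0 ≤ lam := by positivity
  set P : ℝ := lam * (S.card * B)
  have hP0 : 0 ≤ P := by positivity
  set M₁ : ℝ := 13 / 4 * (a₀ + K) + 1 + 6 * a₀
  set M₂ : ℝ := 2 * B + 1 + 2 * a₀
  have hM₁0 : 0 < M₁ := by positivity
  have hM₂1 : 1 ≤ M₂ := by linarith [ha.le]
  refine ⟨r₃ + 3 * P + 48 * P / a₀ + 1024 * K / a₀, min (1 / (2 * M₂)) (a₀ / (4 * M₁)),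
    lt_min (by positivity) (by positivity), fun R hR => ?_⟩
  have h48 : 0 ≤ 48 * P / a₀ := by positivity
  have h1024 : 0 ≤ 1024 * K / a₀ := by positivity
  have hR1 : 1 ≤ R := by linarith
  have hR0 : 0 < R := by linarith
  have hRP : 3 * P ≤ R := by linarith
  have hRP' : 48 * P ≤ a₀ * R :=
    ((div_le_iff₀ ha).1 (by linarith : 48 * P / a₀ ≤ R)).trans_eq (mul_comm _ _)
  have hRK : 1024 * K ≤ a₀ * R :=
    ((div_le_iff₀ ha).1 (by linarith : 1024 * K / a₀ ≤ R)).trans_eq (mul_comm _ _)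
  have hc₁ : min (1 / (2 * M₂)) (a₀ / (4 * M₁)) ≤ 1 :=
    (min_le_left _ _).trans (by rw [div_le_one (by positivity)]; linarith)
  have hcM₁ : min (1 / (2 * M₂)) (a₀ / (4 * M₁)) * M₁ ≤ a₀ / 4 :=
    calc min (1 / (2 * M₂)) (a₀ / (4 * M₁)) * M₁ ≤ a₀ / (4 * M₁) * M₁ :=
          mul_le_mul_of_nonneg_right (min_le_right _ _) hM₁0.le
      _ = a₀ / 4 := by field_simp
  have hcM₂ : min (1 / (2 * M₂)) (a₀ / (4 * M₁)) * M₂ ≤ 1 / 2 :=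
    calc min (1 / (2 * M₂)) (a₀ / (4 * M₁)) * M₂ ≤ 1 / (2 * M₂) * M₂ :=
          mul_le_mul_of_nonneg_right (min_le_left _ _) (by positivity)
      _ = 1 / 2 := by field_simp
  generalize min (1 / (2 * M₂)) (a₀ / (4 * M₁)) = c₁ at hc₁ hcM₁ hcM₂
  -- the potential term `X z = (λ/R²) Σ_{w ∈ S} G(z - w) ∈ [0, P/R²]`
  have hX : ∀ z : Site 3, 0 ≤ lam / R ^ 2 * ∑ w ∈ S, G (z - w) ∧
      lam / R ^ 2 * ∑ w ∈ S, G (z - w) ≤ P / R ^ 2 := fun z => by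
    obtain ⟨hΞ0, hΞ⟩ := subProfile_potential_bounds hGpos hGle S z
    exact ⟨by positivity,
      (mul_le_mul_of_nonneg_left hΞ (by positivity)).trans_eq (div_mul_eq_mul_div _ _ _)⟩
  have hP1 : P / R ^ 2 ≤ 1 := by rw [div_le_one (by positivity)]; nlinarith
  refine ⟨fun y => G y * (1 + 1 / (4 * R ^ 2) * ∑ j, ((y j : ℤ) : ℝ) ^ 2) -
    lam / R ^ 2 * ∑ w ∈ S, G (y - w), fun V τ hτ0 hτ hV => ⟨fun z hz hz3 => ?_, ?_⟩,
    fun z hz1 hz3 => ?_⟩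
  · -- subsolution off the origin
    obtain ⟨hX0, hXP⟩ := hX z
    have hsr : ∑ j, ((z j : ℤ) : ℝ) ^ 2 = Real.sqrt (∑ j, ((z j : ℤ) : ℝ) ^ 2) ^ 2 :=
      (Real.sq_sqrt (Finset.sum_nonneg fun j _ => sq_nonneg _)).symm
    have hr1 : 1 ≤ Real.sqrt (∑ j, ((z j : ℤ) : ℝ) ^ 2) := one_le_sqrt_sum_sq_of_ne_zero hz
    beta_reduce
    rw [subProfile_laplacian_profile hG0 hG1, hG0 z hz, mul_zero, zero_add, hsr]
    by_cases hzr : Real.sqrt (∑ j, ((z j : ℤ) : ℝ) ^ 2) < r₃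
    · -- near sites `z ∈ F₀`
      rw [if_pos ((hS z).2 ⟨hz, hzr⟩), mul_one]
      exact subProfile_arith_near ha hB0 (by linarith) (Real.sqrt_nonneg _) (by linarith) hR1
        (hGpos z).le (hGle z) hX0 (hXP.trans hP1) hτ0 hτ (hV z hz3) hc₁
        (subProfile_phi_lower hGpos hGle z hzr.le)
    · -- far sites `|z| ≥ r₃`
      replace hzr := not_lt.1 hzr
      rw [if_neg (fun h => (not_lt.2 hzr) ((hS z).1 h).2), mul_zero, add_zero]
      have hX1 : lam / R ^ 2 * ∑ w ∈ S, G (z - w) ≤ 1 / Real.sqrt (∑ j, ((z j : ℤ) : ℝ) ^ 2) := by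
        refine hXP.trans ?_
        rw [div_le_div_iff₀ (by positivity) (by linarith)]
        nlinarith [mul_le_mul_of_nonneg_left hz3 hP0]
      exact subProfile_arith_far ha hK hr1 hz3 hR1 (hGpos z).le
        (by linarith [(abs_le.1 (hGasym z hz)).2]) hX0 hX1 hτ0 hτ (hV z hz3) hcM₁ (hmod z hzr).1
  · -- the origin
    obtain ⟨hX0, hXP⟩ := hX 0
    have h0S : (0 : Site 3) ∉ S := fun h => ((hS 0).1 h).1 rfl
    have hs0 : ∑ j, (((0 : Site 3) j : ℤ) : ℝ) ^ 2 = 0 := by simp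
    have hΦ0 : ∑ i : Fin 3, (((0 : Site 3) i : ℤ) : ℝ) *
        (G (0 + Pi.single i 1) - G (0 - Pi.single i 1)) = 0 := by simp
    have hV0 : |V 0| ≤ c₁ / R ^ 2 := hV 0 (by rw [hs0, Real.sqrt_zero]; positivity)
    have key := subProfile_arith_origin ha hR1 (hGpos 0).le (hGle 0) hX0 (hXP.trans hP1) hτ0 hτ
      hV0 hcM₂
    beta_reduce
    rw [subProfile_laplacian_profile hG0 hG1, if_neg h0S, hG1, hs0, hΦ0]
    calc _ = V 0 * (G 0 - lam / R ^ 2 * ∑ w ∈ S, G (0 - w) - τ) - 2 := by ring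
      _ ≤ -(1 + 1 / (4 * R ^ 2)) + 1 / (4 * R ^ 2) * (6 * G 0) := key
      _ = _ := by ring
  · -- two-sided size bound on `R/8 ≤ |z| ≤ 3R`
    obtain ⟨hX0, hXP⟩ := hX z
    have hr0 : 0 < Real.sqrt (∑ i, ((z i : ℤ) : ℝ) ^ 2) := (div_pos hR0 (by norm_num)).trans_le hz1
    have hg := hGasym z (greenMod_ne_zero_of_sumSq_pos z (Real.sqrt_pos.1 hr0))
    have hsr : ∑ j, ((z j : ℤ) : ℝ) ^ 2 = Real.sqrt (∑ j, ((z j : ℤ) : ℝ) ^ 2) ^ 2 :=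
      (Real.sq_sqrt (Finset.sum_nonneg fun j _ => sq_nonneg _)).symm
    have hXR : lam / R ^ 2 * (∑ w ∈ S, G (z - w)) * R ^ 2 ≤ P := (le_div_iff₀ (by positivity)).1 hXP
    beta_reduce
    generalize lam / R ^ 2 * ∑ w ∈ S, G (z - w) = X at hX0 hXR ⊢
    generalize Real.sqrt (∑ j, ((z j : ℤ) : ℝ) ^ 2) = r at hg hz1 hz3 hsr ⊢
    rw [hsr, show 1 + 1 / (4 * R ^ 2) * r ^ 2 = 1 + r ^ 2 / (4 * R ^ 2) by ring]
    exact subProfile_arith_size ha hR1 hz1 hz3 hg hRK hX0 hXR hRP'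

end Summit.CriticalPhenomena.Ising3DConformalLimit.Theorems.PositiveSolutionAsymptotics
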